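import Mathlib
import Summits.ResolutionOfSingularities.ResolutionOfSingularities.Theorems.RadicialJungCleanModelsContactDrop
import Literature.AlgebraicGeometry.Resolution.StrictTransformTransverseCurve
import Literature.AlgebraicGeometry.Resolution.ColonIdealSheafFG
import Literature.AlgebraicGeometry.Resolution.BlowupChartMembership
import Literature.AlgebraicGeometry.Resolution.MarkedIdealsLemmas
import Literature.AlgebraicGeometry.Resolution.StalkIdealLemmas
import Literature.AlgebraicGeometry.Resolution.PermissibleCentres
import HarnessLib

/-!
# Route `RadicialJung`, crux `CleanModels` (stmt-ResolutionOfSingularities-15917), line `Sketch` rev 20, stub 4e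
# `stub_cleanPrincipalization3`: toward L7b — THE CONTACT DROPS BY ONE, SCHEME LEVEL (one point blow-up on a regular curve)

Memo `Cruxes/CleanModels/Lines/Sketch-memo-4e-cleanPermissible.md` rev 11.2, §2.3 `(μ,1)` (a) / rev 10 §3 (L7b phase 1) / §4.1 (O8): the
one-step statement of the «first cycle» at the level of SCHEMES.  For the blowing up `π : X' → X` (`IsBlowup`, universal property) of a
regular locally Noetherian scheme `X` at a closed point `x` (reduced point subscheme regular) lying on a regular curve `C` (reduced ideal
generated at each point by a pair of a regular system of parameters) through a threefold point (`dim 𝒪_{X,x} = 3`), and a point `c'` of the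
strict transform `C̃ = cl(π⁻¹(C ∖ {x}))` over `x`: the three standard inputs of `ContactDrop.lean` (✓ p690181) HOLD —
(i) `𝔪_x 𝒪_{X',c'} = (e)` with `e` regular (`IsBlowup.isEffectiveCartier` + `IsEffectiveCartier.exists_stalkIdeal_eq_span`),
(ii) `𝓘_C 𝒪_{X',c'} ⊆ e · 𝓘_{C̃,c'}` (`IsBlowup.pow_mul_controlledTransform_eq` with `μ = 1`, `controlledTransform ≤ strictTransformIdeal`,
`vanishingIdeal_closure_eq_strictTransformIdeal_of_transverse`), (iii′) `𝓘_{C̃,c'} + (e) = 𝔪_{c'}` (`exists_isRsopPart_strictTransform_of_transverse`)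
— so the contact normal form `s = γ w^k + π` (`γ` unit, `π ∈ 𝓘_{C,x}`, `(𝓘_{C,x}, w) = 𝔪_x`) of a surface `V(s)` having contact `k ≥ 1` with `C` at
`x` maps under `π^#_{c'}` to `e · (γ₁ e^{k−1} + π₁)`, `γ₁` a unit, `π₁ ∈ 𝓘_{C̃,c'}`, `(𝓘_{C̃,c'}, e) = 𝔪_{c'}`: CONTACT `k − 1` w.r.t. the new
transversal coordinate `e`, with the clean-monomial bookkeeping `π^#(u w^A s^a) = (unit) e^{A+a} (γ₁ e^{k−1} + π₁)^a`.
* `contact_drop_of_isBlowup_point`.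
* `strictTransform_curve_data_of_isBlowup_point` — the hypotheses reproduce themselves at `c'` (`X'` regular, `C̃` a regular curve at each of
  its points, `dim 𝒪_{X',c'} = 3`), so phase 1 of L7b is an induction along any chain of point blowing ups following the curve.
Iterating it `k` times along the points of `C̃` over `x` is L7b phase 1 (memo rev 10 §3); the terminal step is `isUnit_contact_drop_one` /
`cleanPermissibleAt_of_split` (✓ p685976).

Honest framing: OURS, assembly of tree results; nothing here proves resolution in characteristic `p` or any case of `CleanModels`.
-/

noncomputable section

set_option linter.dupNamespace false -- mandated namespace of this single-conjunct summit

open CategoryTheory AlgebraicGeometry TopologicalSpace IsLocalRing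
open Literature.AlgebraicGeometry.Resolution
open Scheme.IdealSheafData

universe u

namespace Summit.ResolutionOfSingularities.ResolutionOfSingularities.Theorems.RadicialJung.CleanModels

/-- **The contact drops by one under the blowing up of a closed point of a regular curve (scheme level).**  See the module docstring.
[cite: CossartPiltant2008, Prop. 4.4 (proof, p. 10)] [cite: CossartJannsenSaito2020, proof of Thm. 6.28, Step 5] -/
theorem contact_drop_of_isBlowup_point {X X' : Scheme.{u}} [IsLocallyNoetherian X] [IsLocallyNoetherian X'] {π : X' ⟶ X}
    (hX : Scheme.IsRegular X) {c' : X'} (hx : IsClosed ({π c'} : Set X))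
    (hYreg : Scheme.IsRegular (vanishingIdeal (⟨{π c'}, hx⟩ : Closeds X)).subscheme)
    (hπ : IsBlowup π (vanishingIdeal (⟨{π c'}, hx⟩ : Closeds X))) {C : Closeds X}
    (hCreg : ∀ y ∈ (C : Set X), ∃ c : Fin 2 → X.presheaf.stalk y,
      IsRsopPart c ∧ Ideal.span (Set.range c) = stalkIdeal (vanishingIdeal C) y)
    (hxC : π c' ∈ (C : Set X)) (hdim : ringKrullDim (X.presheaf.stalk (π c')) = 3)
    (hc' : c' ∈ closure (π ⁻¹' ((C : Set X) \ {π c'})))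
    (w γ u s₀ : X.presheaf.stalk (π c')) (hw : stalkIdeal (vanishingIdeal C) (π c') ⊔ Ideal.span {w} = maximalIdeal _)
    (hγ : IsUnit γ) (hs₀ : s₀ ∈ stalkIdeal (vanishingIdeal C) (π c')) (k : ℕ) (hk : 1 ≤ k) (A a : ℕ) :
    ∃ e : X'.presheaf.stalk c',
      stalkIdeal ((vanishingIdeal (⟨{π c'}, hx⟩ : Closeds X)).comap π) c' = Ideal.span {e} ∧
      stalkIdeal (vanishingIdeal (⟨closure (π ⁻¹' ((C : Set X) \ {π c'})), isClosed_closure⟩ : Closeds X')) c' ⊔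
          Ideal.span {e} = maximalIdeal _ ∧
      ∃ (γ₁ : X'.presheaf.stalk c') (_ : IsUnit γ₁) (v₁ : X'.presheaf.stalk c') (_ : IsUnit v₁) (π₁ : X'.presheaf.stalk c')
        (_ : π₁ ∈ stalkIdeal (vanishingIdeal (⟨closure (π ⁻¹' ((C : Set X) \ {π c'})), isClosed_closure⟩ : Closeds X')) c'),
        (π.stalkMap c').hom (γ * w ^ k + s₀) = e * (γ₁ * e ^ (k - 1) + π₁) ∧
        (π.stalkMap c').hom (u * w ^ A * (γ * w ^ k + s₀) ^ a) =
          ((π.stalkMap c').hom u * v₁) * e ^ (A + a) * (γ₁ * e ^ (k - 1) + π₁) ^ a := by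
  set Y : Closeds X := ⟨{π c'}, hx⟩
  set Ct : Closeds X' := ⟨closure (π ⁻¹' ((C : Set X) \ {π c'})), isClosed_closure⟩
  -- the curve ideal at `x` lies in the maximal ideal
  have hPle : stalkIdeal (vanishingIdeal C) (π c') ≤ maximalIdeal _ :=
    (mem_support_iff_stalkIdeal_le _ _).mp
      (by rw [← SetLike.mem_coe, Scheme.IdealSheafData.coe_support_vanishingIdeal]; exact hxC)
  -- transversality of `C` and `Y = {x}` at `x`, and the dimension hypothesis, in the form the tree lemmas want
  have htr : ∀ y ∈ (C : Set X) ∩ Y, stalkIdeal (vanishingIdeal C) y ⊔ stalkIdeal (vanishingIdeal Y) y = maximalIdeal _ := by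
    rintro y ⟨-, hy⟩
    have hy' : y = π c' := hy
    subst hy'
    rw [stalkIdeal_vanishingIdeal_singleton hx]
    exact sup_eq_right.mpr hPle
  have hdim' : ∀ y ∈ (C : Set X) ∩ Y, ringKrullDim (X.presheaf.stalk y) = 3 := by
    rintro y ⟨-, hy⟩
    have hy' : y = π c' := hy
    subst hy'
    exact hdim
  -- the strict transform: its ideal, and its transversality to the exceptional divisor at `c'`
  have hIeq : vanishingIdeal Ct = strictTransformIdeal π (vanishingIdeal Y) (vanishingIdeal C) :=
    (vanishingIdeal_closure_eq_strictTransformIdeal_of_transverse hπ hCreg htr hdim').1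
  have htrans : stalkIdeal (vanishingIdeal Ct) c' ⊔ stalkIdeal ((vanishingIdeal Y).comap π) c' = maximalIdeal _ :=
    (exists_isRsopPart_strictTransform_of_transverse hπ hCreg htr hdim' hX hYreg hc').2 (Set.mem_singleton _)
  -- (i) the exceptional ideal is principal at `c'`, generated by a regular element `e`
  obtain ⟨e, he0, he⟩ := hπ.isEffectiveCartier.exists_stalkIdeal_eq_span c'
  -- the stalk map and the two ideals
  set φ := (π.stalkMap c').hom with hφ
  set P := stalkIdeal (vanishingIdeal C) (π c') with hP
  set P' := stalkIdeal (vanishingIdeal Ct) c' with hP'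
  have hP'le : P' ≤ maximalIdeal _ :=
    (mem_support_iff_stalkIdeal_le _ _).mp
      (by rw [← SetLike.mem_coe, Scheme.IdealSheafData.coe_support_vanishingIdeal]; exact hc')
  -- `𝔪_x 𝒪' = (e)`
  have hmx : (maximalIdeal (X.presheaf.stalk (π c'))).map φ = Ideal.span {e} := by
    rw [← stalkIdeal_vanishingIdeal_singleton hx, hφ, ← stalkIdeal_comap_eq_map_stalkMap, he]
  have hmle : (P ⊔ Ideal.span {w}).map φ ≤ Ideal.span {e} := by rw [hP, hw, hmx]
  have hemem : e ∈ (P ⊔ Ideal.span {w}).map φ := by rw [hP, hw, hmx]; exact Ideal.mem_span_singleton_self e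
  -- (ii) `𝓘_C 𝒪' ⊆ e · 𝓘_{C̃}`
  have hPP' : P.map φ ≤ Ideal.span {e} * P' := by
    have hCY : vanishingIdeal C ≤ vanishingIdeal Y :=
      vanishingIdeal_antimono (fun z hz => by have hz' : z = π c' := hz; subst hz'; exact hxC)
    have hle1 : (vanishingIdeal C).comap π ≤ (vanishingIdeal Y).comap π ^ 1 := by
      rw [pow_one]; exact comap_mono _ hCY
    have hprod := hπ.pow_mul_controlledTransform_eq hle1
    have hst : (vanishingIdeal C).comap π ≤ (vanishingIdeal Y).comap π * vanishingIdeal Ct := by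
      rw [hIeq, ← hprod, pow_one]
      exact (show (vanishingIdeal Y).comap π * controlledTransform π (vanishingIdeal Y) (vanishingIdeal C) 1 ≤
          (vanishingIdeal Y).comap π * strictTransformIdeal π (vanishingIdeal Y) (vanishingIdeal C) from
        fun U => Ideal.mul_mono_right (controlledTransform_le_strictTransformIdeal _ _ _ _ U))
    calc P.map φ = stalkIdeal ((vanishingIdeal C).comap π) c' := by rw [hP, hφ, stalkIdeal_comap_eq_map_stalkMap]
      _ ≤ stalkIdeal ((vanishingIdeal Y).comap π * vanishingIdeal Ct) c' := stalkIdeal_mono hst c'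
      _ = Ideal.span {e} * P' := by rw [stalkIdeal_mul, he, hP']
  -- the local-algebra package
  obtain ⟨γ₁, hγ₁, v₁, hv₁, π₁, hπ₁, h1, h2⟩ :=
    contact_drop φ e he0 P P' hP'le w hmle hemem hPP' γ u s₀ hγ (by rw [hP]; exact hs₀) k hk A a
  refine ⟨e, he, ?_, γ₁, hγ₁, v₁, hv₁, π₁, hπ₁, h1, h2⟩
  rw [← he]
  exact htrans

/-- **The data reproduce themselves one level up** (so that L7b phase 1 is an induction along any chain of point blowing ups following the
curve): under the hypotheses of `contact_drop_of_isBlowup_point` — `X` regular locally Noetherian, `π` the blowing up of the closed point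
`x = π c'` (regular point subscheme), `C` a regular curve through `x` (reduced ideal generated by a pair of a regular system of parameters at each
point), `dim 𝒪_{X,x} = 3`, `c' ∈ C̃` — the blown-up scheme `X'` is regular, the strict transform `C̃ = cl(π⁻¹(C ∖ {x}))` is again a regular curve
in the same sense at EACH of its points, and `dim 𝒪_{X',c'} = 3`.  Assembly of `IsBlowup.isRegular_of_isRegular_subscheme`,
`exists_isRsopPart_strictTransform_of_transverse` and `ringKrullDim_stalk_eq_three_of_transverse`.
[cite: CossartPiltant2008, Prop. 4.4 (proof, p. 10)] [cite: Matsumura1987, Thm. 15.6] -/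
theorem strictTransform_curve_data_of_isBlowup_point {X X' : Scheme.{u}} [IsLocallyNoetherian X] [IsLocallyNoetherian X'] {π : X' ⟶ X}
    (hX : Scheme.IsRegular X) {c' : X'} (hx : IsClosed ({π c'} : Set X))
    (hYreg : Scheme.IsRegular (vanishingIdeal (⟨{π c'}, hx⟩ : Closeds X)).subscheme)
    (hπ : IsBlowup π (vanishingIdeal (⟨{π c'}, hx⟩ : Closeds X))) {C : Closeds X}
    (hCreg : ∀ y ∈ (C : Set X), ∃ c : Fin 2 → X.presheaf.stalk y,
      IsRsopPart c ∧ Ideal.span (Set.range c) = stalkIdeal (vanishingIdeal C) y)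
    (hxC : π c' ∈ (C : Set X)) (hdim : ringKrullDim (X.presheaf.stalk (π c')) = 3)
    (hc' : c' ∈ closure (π ⁻¹' ((C : Set X) \ {π c'}))) :
    Scheme.IsRegular X' ∧
      (∀ y' ∈ closure (π ⁻¹' ((C : Set X) \ {π c'})), ∃ c : Fin 2 → X'.presheaf.stalk y',
        IsRsopPart c ∧ Ideal.span (Set.range c) =
          stalkIdeal (vanishingIdeal (⟨closure (π ⁻¹' ((C : Set X) \ {π c'})), isClosed_closure⟩ : Closeds X')) y') ∧
      ringKrullDim (X'.presheaf.stalk c') = 3 := by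
  set Y : Closeds X := ⟨{π c'}, hx⟩
  have hPle : stalkIdeal (vanishingIdeal C) (π c') ≤ maximalIdeal _ :=
    (mem_support_iff_stalkIdeal_le _ _).mp
      (by rw [← SetLike.mem_coe, Scheme.IdealSheafData.coe_support_vanishingIdeal]; exact hxC)
  have htr : ∀ y ∈ (C : Set X) ∩ Y, stalkIdeal (vanishingIdeal C) y ⊔ stalkIdeal (vanishingIdeal Y) y = maximalIdeal _ := by
    rintro y ⟨-, hy⟩
    have hy' : y = π c' := hy
    subst hy'
    rw [stalkIdeal_vanishingIdeal_singleton hx]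
    exact sup_eq_right.mpr hPle
  have hdim' : ∀ y ∈ (C : Set X) ∩ Y, ringKrullDim (X.presheaf.stalk y) = 3 := by
    rintro y ⟨-, hy⟩
    have hy' : y = π c' := hy
    subst hy'
    exact hdim
  refine ⟨hπ.isRegular_of_isRegular_subscheme hX hYreg, fun y' hy' =>
    (exists_isRsopPart_strictTransform_of_transverse hπ hCreg htr hdim' hX hYreg hy').1, ?_⟩
  -- `c'` is a point of the schematic strict transform; the dimension formula there
  have hc'supp : c' ∈ ((strictTransformIdeal π (vanishingIdeal Y) (vanishingIdeal C)).support : Set X') := by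
    rw [support_strictTransformIdeal_eq_closure, Scheme.IdealSheafData.coe_support_vanishingIdeal,
      Scheme.IdealSheafData.coe_support_vanishingIdeal]
    exact hc'
  obtain ⟨v', hv'⟩ : c' ∈ Set.range (strictTransformIdeal π (vanishingIdeal Y) (vanishingIdeal C)).subschemeι := by
    rw [range_subschemeι]; exact hc'supp
  rw [← hv']
  exact ringKrullDim_stalk_eq_three_of_transverse hπ hCreg htr hdim' hX v' (by rw [hv']; exact Set.mem_singleton _)

end Summit.ResolutionOfSingularities.ResolutionOfSingularities.Theorems.RadicialJung.CleanModels

end
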